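import Summits.CriticalPhenomena.SAWScalingLimit.Theorems.SAWRenewalTightnessTightIdentificationGlue
import Summits.CriticalPhenomena.SAWScalingLimit.Theses.SAWEdgeOfPositiveType

/-!
# Route `SAWEdgeOfPositiveType`: the tightness–identification criterion

Item `stmt-CriticalPhenomena-10873` (`TightIdentificationCriterion`): for every Dobrushin domain
and endpoint approximation, set-level tightness of the pushed critical SAW laws on some initial
mesh interval `(0, δ₀]` and identification of every subsequential weak limit along `δ_n → 0⁺` as
the chordal SLE_{8/3} law imply `ConvergesInLawToSLE (8/3)`. Immediate from
`saw_convergesInLawToSLE_of_isTightMeasureSet_image` of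
`SAWRenewalTightnessTightIdentificationGlue.lean` (which, as the item's docstring foresees, runs
the criterion on the push-forward side so that no probability instance is needed at junk meshes).

## References

* P. Billingsley, *Convergence of Probability Measures*, 2nd ed. (1999), Thm. 5.1 and its
  Corollary [BillingsleyCPM1999].
-/

noncomputable section

namespace Summit.CriticalPhenomena.SAWScalingLimit.Theorems

/-- **Item `stmt-CriticalPhenomena-10873` (`SAWEdgeOfPositiveType.TightIdentificationCriterion`).**
Tightness of `{(SAW.law …).map curve : δ ∈ (0, δ₀]}` plus identification of the subsequential
limit laws give convergence in law of the critical SAW to chordal SLE_{8/3}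
(`saw_convergesInLawToSLE_of_isTightMeasureSet_image`).
[cite: BillingsleyCPM1999, Thm. 5.1, Corollary] -/
theorem edgeOfPositiveType_tightIdentificationCriterion_proof :
    Theses.SAWEdgeOfPositiveType.TightIdentificationCriterion := by
  intro D a b hab δ₀ hδ₀ htight hI
  refine saw_convergesInLawToSLE_of_isTightMeasureSet_image hab hδ₀ htight ?_
  rintro μ hμ ⟨s, hs, hlim⟩
  exact hI s μ hs hμ hlim

end Summit.CriticalPhenomena.SAWScalingLimit.Theorems
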